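import Summits.QuantumFields.YangMills.Theorems.BalabanUVNodesN12AtRecord13SepCoPHSocketsPinnedWindow
import Summits.QuantumFields.YangMills.Theorems.BalabanUVNodesN12AtTheta13OfThm1CCMWCubeOfStubsSignFreeAllTorus

/-!
# BalabanUVNodes ∕ N12 — THE K0⁷ → K1⁷ JUNCTION ON THE SIGN-FREE ROAD WITH N12's SHORTEST LOCATED LIST, ALL-TORUS EDITION AND THE WINDOW BINDERS PARED TO ONE: 12Zᴬ-b
# `…N12AtTheta13OfThm1CCMWCubeOfStubsSignFreeWindow` (p572980) WITH `4 ≤ F.m`, `γ ≤ ½`, `0 ≤ β′`, `γ²β′ ≤ 1` GONE — the K1⁷ v5 rung body at the door-cured window-edition witness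
# `θ₁₅ᶜᶜᴹ(3;γ)(B₃, B₉·B₃, a₀, min a₁ (a₀''∕B₃))` on EVERY family, K-side = V17's stub letters (stubs 1∕2, the SIGN-FREE stub 3ᴬ's conclusion as the two-sided box letters at `γ`) + ONE window choice
# `γ ≤ e⁻³`, N12 read at its layer of record `λᴾ` — the one sign-dependent input N12 keeps is `β ≥ 0` along each run's history (`hβhist`, NODE O's letter FOR N12) (Track A, DAG node N12 = [B15,
# Balaban1989LargeFieldI] CMP **122** (1989) 175–202; cluster K1 — K1⁷ `StabilityBAtRecordR13SepCoPH` = stmt-QuantumFields-20542, helper; seat `pub-ymgap-dag-n12-d` g15 (R134 s2 «knit at the record»),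
# 2026-08-27; count-neutral, CONDITIONAL, NOT a discharge)

HONEST FRAMING.  Count-neutral kernel COMPOSITION BY NAME — 12Zᴬ-b re-run over (i) dag-n21-c g13's all-torus Eʷ road (bus l.23551: row `bg` is guarded by `PartCompat₁₃`, which excludes wrapping
(1.12) cubes, so `hsN` holds on every family; K-side input `hP :=` the all-torus §0 `provisos₁₃SepCoP_theta13OfThm1CCMW_cube_of_prop8TopStep_of_prop6Member_of_betaBoxSignFree_allTorus` of the companion
file) and (ii) this seat's 12Iᵂ v1.2 §3 «the effective window in kernel form»: the closer's ONE window statement `γ ≤ e⁻³` yields `γ ≤ ½` (`exp_neg_three_lt_half`) for A1ʷ∕A2ʷ∕Dʷ's `_of_half`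
transfers and for 12Iᵂ §0's flow-profile letter, and NODE O's `SmallnessFor γ (max β′ 0) ½ 2 1` + the (2.7) bound `BetaUpperH (max β′ 0) γ β₁₃` are fed at the NON-NEGATIVE bound `max β′ 0` (the box
transfers by `le_max_left`; `γ²·max β′ 0 ≤ 1` from 3ᴬ's letter `β′γ² ≤ ¾`), so neither `0 ≤ β′` nor `γ²β′ ≤ 1` is a binder any more.  Everything else VERBATIM from 12Zᴬ-b: 12Wᵂ-H §2 at A1ʷ's family,
K0b's residuals, admissibility ∘ A1ʷ, term signs (12Y), `β ≥ 0` along each run's history DISPLAYED (`hβhist` — the coupling step of the (1.89) pin reads it, 12N), `r = p₀ = M₂ = 1`, `M = L³`,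
`θ.γ = γ` (`rfl`), the witness letters `B₃' = B₉·B₃`, `a₁' = min a₁ (a₀''∕B₃)` as display equations (`subst`).  WHAT IT SHOWS: on V17's sign-free road the K1⁷ rung body (v5 `stub_nodes13PWS`, N = 2) at
the K0⁷ witness needs from the K-side EXACTLY the skeleton's three stub letters and the closer's window choice `γ := min γ₀ (min e⁻³ (1+|β′|)⁻¹)` inside 3ᴬ's window `γ₀` (box letters at `γ` by
`box_mono`; `−bl·γ² ≤ 3`, `β′γ² ≤ ¾`, `γ ≤ e⁻³`) — no torus-size branch, no `½`, no sign of the bound; and N12's per-run located inputs below the torus are UNCHANGED from 12Zᴬ-b: live-mass (NODE 00),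
`β ≥ 0` along the history (NODE O — the one place N12 reads the sign), Prop. 1 at `λ.LF P` (dag-n12-c ∕ 12Q⁵), the run's window `Step.InInterval γ (kSel P + 1) g`, the levels `N₀ ≤ N P`,
`N₀ ≤ kSel P + 1`, the base situation's residual NUMBERS (`0 ≤ β ≤ ¼`, `2 ≤ L₀`, `L₀² ≤ L`, `0 ≤ O(1)B₃B₅`, `0 ≤ δ`), print's two p. 200 conditions `hwin`∕`hMl` (reading `M = L³`), `Λ ≠ ∅`, the four
ℍ-leaves + (1.80) (N07).  WHICH CHILD BLOCKS otherwise: N05 `h05S`, N06 `h06`, N07 `h07`, N08 `h08`, N09 `h09`+`h09T`, N10 `h10`, N11 `h11` (S1ᵀ), (UV₁₃) `hUV`, the S-bound world binding, the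
mixed W-pin `hW ∕ hWdeg`, `hsel`.  Stub 3ᴬ's box and the sign of β are NODE O's; nothing of Bałaban's is asserted; every printed fact is a hypothesis; N12 is NOT discharged; no node is discharged;
K0⁷ ∕ K1⁷ NOT closed; counts unmoved (discharged 5∕27 · Track A 5∕28).  ONE finite four-torus programme at fixed `ε = L^{-K}` — nothing continuum ∕ ℝ⁴ ∕ OS ∕ mass gap ∕ Clay.  No `sorry`,
`def`, `instance`, `notation`.

Sources: [Balaban1989LargeFieldI] (0.2)–(0.6) p.176, (1.2) p.178, (1.10)–(1.11) p.179, (1.73) p.192, Prop. 1 (1.78) p.194, (1.80) p.195, (1.89) p.198, (1.91)–(1.102) pp.199–201;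
[Balaban1989LargeFieldII] Thm 1 + (0.1) pp.355–356, (1.4) p.357; [Balaban1988Convergent] (2.1)–(2.9) pp.254–256, (2.10)–(2.12) p.256, (2.13) p.257, (2.17) p.257, Thm 1 p.262, (3.16)–(3.25)
pp.268–270; [Balaban1985Variational] Thm 1 (8)–(9) p.279, (144)–(152) pp.300–301, Prop. 8 p.304; [Balaban1985RegularSpaces] (1.3)–(1.9) p.77, Prop. 6 p.99, (1.130) p.99, Thm 8 p.101;
[Balaban1987RG1] Thm 1 p.259, (0.20)–(0.21) p.256, (1.11)–(1.12) p.262, §1 (1.20)–(1.22) p.264.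
-/

noncomputable section

open MeasureTheory
open scoped Matrix.Norms.L2Operator

namespace Summit.QuantumFields.YangMills.BalabanUVNodes.N12AtTheta13OfThm1CCMWCubeOfStubsSignFreeAllTorusWindow

open Literature.MathematicalPhysics.QuantumFieldTheory.Balaban1983to89
open Literature.MathematicalPhysics.QuantumFieldTheory.Balaban1983to89.T4Continuum (T4Family)
open Literature.MathematicalPhysics.QuantumFieldTheory.Balaban1983to89.DagBinding
open Literature.MathematicalPhysics.QuantumFieldTheory.Balaban1983to89.Node00
open FlowStep (BetaLowerH BetaUpperH)
open FlowStepRuns (genFlow)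
open B15Claim189Assembly (Setting189 new189 chiPP dom half)
open B15 (Prop1Printed Ineq180)
open B15.BasicStep (Claim189)
open B15.PrelimIntegrations (Ineq191 Ineq195)
open B15Chi124DetSets (E124)
open B15DeterminingSets (MSField)
open B14DomainGeom (Pt)
open B8Eq17ClassAkV1 (plaqsOf)
open GaugeGroup (dist1)
open GaugeField (plaqHol)
open B15RPrime1100OfRep (rPrimeDataOfSel)
open B15Claim189PrintedConditions (omegaOfChain)
open B15Claim189PinsOfHistory (sitOfHist N0OfRecord₁₃ D189OfHist)
open B15Claim189LambdaPin (enlD)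
open B16RLeafRecord13LiveCoPH (laws₁₃CoPH_liveRepin₁₃_of_hasResiduals)
open Summit.QuantumFields.YangMills.BalabanUVNodes.N12AtRecord13SepCoPHSockets (nodes₁₃CoPH_upS_fourPinW₀_pointed recordS₁₃SepCoPH_of_upS_pinB10YZW₀)

open FlowStep (prefixOf BetaUpperH)
open B14FlowStep (SmallnessFor)

open FlowStep (BetaLowerH)
open B15Claim189N0OfRecord (betaAlongHistory_nonneg_of_betaLowerH)
open Summit.QuantumFields.YangMills.BalabanUVNodes.N12AtTheta13OfThm1CCM (kappa_nonneg_theta13OfThm1CCM E0_nonneg_theta13OfThm1CCM B0_nonneg_theta13OfThm1CCM)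
open Summit.QuantumFields.YangMills.BalabanUVNodes.N12AtTheta13OfThm1CCMWCubeOfStubsSignFreeAllTorus (provisos₁₃SepCoP_theta13OfThm1CCMW_cube_of_prop8TopStep_of_prop6Member_of_betaBoxSignFree_allTorus)
open Summit.QuantumFields.YangMills.BalabanUVNodes.N12AtRecord13SepCoPHSocketsPinnedWindow (nodesAtSomeRecordS₁₃SepCoPH_of_upS_fourPinW₀_pinnedΛΩχZ_ofHistoryBlind_ofCured_liveRepin₁₃_of_massLive_of_hasResiduals_of_inInterval)
open Summit.QuantumFields.YangMills.BalabanUVNodes.N12AtTheta13OfThm1CCMWSmallWindow (gamma_mul_p0Profile_le_tenth smallnessFor_half_two_one exp_neg_three_lt_half)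
open Summit.QuantumFields.YangMills.Theorems.K0ROfStepTokensRCube (shrunkCeiling_pos)

variable {F : T4Family}

section Helpers
variable {B₃ B₁ : ℝ}

/-- `0 < B₃` from stub 1's inhabitation floor `2L² ≤ B₃` (`L ≥ 2`). [cite: Balaban1985Variational, Thm 1 p.279 (bookkeeping)] -/
private theorem floor_pos (hB₃ : 2 * (F.L : ℝ) ^ 2 ≤ B₃) : 0 < B₃ :=
  lt_of_lt_of_le (mul_pos two_pos (pow_pos (by exact_mod_cast lt_trans Nat.zero_lt_one F.hL.2) 2)) hB₃

/-- `0 ≤ B₃` from the floor. [cite: Balaban1985Variational, Thm 1 p.279 (bookkeeping)] -/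
private theorem floor_nonneg (hB₃ : 2 * (F.L : ℝ) ^ 2 ≤ B₃) : 0 ≤ B₃ := (floor_pos hB₃).le

/-- `0 ≤ B₉·B₃` (FILE 29's `b9Of_pos`). [cite: Balaban1985Variational, (9) p.279, (152) p.301 (bookkeeping)] -/
private theorem b9_mul_nonneg (hB₃ : 2 * (F.L : ℝ) ^ 2 ≤ B₃) (hB₁ : 0 ≤ B₁) : 0 ≤ b9Of F (F.L ^ 3) B₁ * B₃ :=
  mul_nonneg (b9Of_pos (F := F) (F.L ^ 3) hB₁).le (floor_nonneg hB₃)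

end Helpers

section RungOfStubsWindow
variable (B₃ a₀ a₁ B₁ c₁ B₃' a₁' γ ε₀ ε₂₉ : ℝ) (lam : ResidW F 2) (σ : ∀ P : B12.RunParams, Sit189 F 2 P.K)
  (s : ∀ P : B12.RunParams, SeqOfRecord F (theta13OfThm1CCMW F 2 3 γ ε₀ ε₂₉ B₃ B₃' a₀ a₁').ν (theta13OfThm1CCMW F 2 3 γ ε₀ ε₂₉ B₃ B₃' a₀ a₁').τ9.M (gOfRecord₁₃ F 2 (theta13OfThm1CCMW F 2 3 γ ε₀ ε₂₉ B₃ B₃' a₀ a₁') P) P.K (lam.kSel P + 1)) (Nm : B12.RunParams → ℕ) (p₁ : ℕ)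
  (Mstar : ℕ) (ops : OpsY 2 (theta13OfThm1CCMW F 2 3 γ ε₀ ε₂₉ B₃ B₃' a₀ a₁').toStage3Params Mstar) (ζ : ResidZ F 2) (W₀ : B12.RunParams → PrintedCarriers15) (w : WorldP)

/-- **★★★★★ THE K0⁷ → K1⁷ JUNCTION ON THE SIGN-FREE ROAD (V17) WITH N12's SHORTEST LOCATED LIST** — 12Wᵂ-H §2 (the door-cured ΛΩχZ-pinned socket in (2.7)-small-window form) AT the window-edition
witness `Θ := theta13OfNumerics … (stage12NumericsOfThm1CCMW F.L 3 γ ε₀ B₃ B₃' a₀ a₁') …` (₁₃ live re-pin = `θ₁₅ᶜᶜᴹ(3;γ)` by `rfl`; = dag-n21-c Cʷ's large-torus `θ`) with the K1-side input `hP :=` the ALL-TORUS 12Zᴬ §0 of the companion file (SIGN-FREE, NO `4 ≤ F.m`: the two comparability clauses from the two-sided box, dag-n21-c Dʷ ∘ all-torus Eʷ) and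
the window-side inputs discharged EXCEPT ONE: the (2.7) bound ⟸ the upper box (A2ʷ), but `β ≥ 0` ALONG EACH RUN's HISTORY (`hβhist`) STAYS DISPLAYED — N12 reads the sign of β through the coupling
step of the (1.89) pin (12N), K0 does not (plan SIGNFREE-WORD); NODE O's `SmallnessFor γ (max β′ 0) ½ 2 1` and the (2.7) bound at the NON-NEGATIVE bound `max β′ 0` ⟸ `γ ≤ e⁻³` and 3ᴬ's `β′γ² ≤ ¾` (12Iᵂ `smallnessFor_half_two_one`; the box transfers by `le_max_left`), `γ ≤ ½` ⟸ `γ ≤ e⁻³` (12Iᵂ v1.2 `exp_neg_three_lt_half`), the flow-profile letter ⟸ `A₀ᶜᶜ¹ ≤ 1∕16` (12Iᵂ §0, K0a), `r = p₀ = M₂ = 1`, `M = L³`, term signs,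
admissibility, K0b's residuals (K0a ∕ 12Y ∕ A1ʷ).  WHAT THE K1⁷ CLOSER OF `stub_nodes13PWS` STILL SUPPLIES on V17's road (the hypothesis list, nothing hidden): K-side = stub 1 `hB₃ ha₀ ha₁ h8`, stub 2
`hB₁ hc₁ hP6`, the sign-free stub's conclusion `hγ0 hε hε' hβlo hβhi hl hu` at `γ`, the ONE window choice `γ ≤ e⁻³` (NO `4 ≤ F.m`, NO `γ ≤ ½`, NO `0 ≤ β′`, NO `γ²β′ ≤ 1` binder); the S-bound world binding `hC hγ hL hup` (`w.γ ≤ γ`); N05 `h05S`,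
N06 `h06`, N07 `h07`, N08 `h08`, N09 `h09`+`h09T`, N10 `h10`, N11 `h11`, (UV₁₃) `hUV`; the mixed W-pin `hW ∕ hWdeg` at N12's layer of record `λᴾ` and `hsel`; and PER RUN BELOW THE TORUS only:
live-mass (NODE 00), Prop. 1 at `λ.LF P` (dag-n12-c ∕ 12Q⁵: [15] from stub 1), the run's window `hI` up to `kSel P + 1`, `β ≥ 0` along the history `hβhist` (NODE O, for N12), the levels `hNN ∕ hNk`, the base situation's residual numbers `hβ0 hβ hL₀ hL₀L hB hδ`,
print's p. 200 conditions `hwin ∕ hMl`, `Λ ≠ ∅`, the four ℍ-leaves + (1.80) `L91h L95 L91 L97 L80` (N07).  NO flow, coupling-step, `ε`-range, `hN₀`, `hlog`, `SmallnessFor`, proviso, admissibility or sign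
display.  The conclusion IS the registered `NodesAtSomeRecord13PWS F` body (N = 2).  COMPOSITE and CONDITIONAL: every stub letter and node row a HYPOTHESIS; nothing of Bałaban asserted; no node
discharged; K0⁷ ∕ K1⁷ NOT closed; the `F.m ≤ 3` families are the declared residual. [cite: Balaban1989LargeFieldII, Thm 1 p.355, (0.1) pp.355–356, (1.4) p.357, p.391; Balaban1989LargeFieldI, (0.2)–(0.6) p.176, (1.2) p.178, (1.10)–(1.11) p.179, (1.73) p.192, Prop. 1 (1.78) p.194, (1.80) p.195, (1.89) p.198, (1.91)–(1.102) pp.199–201; Balaban1988Convergent, (2.1)–(2.9) pp.254–256, (2.17) p.257, (2.20)–(2.22) p.258, Thm 1 p.262, (3.16)–(3.25) pp.268–270; Balaban1987RG1, Thm 1 p.259, (0.20)–(0.21) p.256, (1.12) p.262, §1 (1.20)–(1.22) p.264; Balaban1985RegularSpaces, (1.3)–(1.6) p.77, Prop. 6 p.99, Thm 8 p.101; Balaban1985Variational, Thm 1 (8)–(9) p.279, (152) p.301, Prop. 8 p.304 (bookkeeping)] -/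
theorem nodesAtSomeRecordS₁₃SepCoPH_of_upS_fourPinW₀_pinnedΛΩχZ_ofHistoryBlind_ofCured_theta13OfThm1CCMW_cube_of_massLive_of_prop8TopStep_of_prop6Member_of_betaBoxSignFree_allTorus_of_window
    -- stub 1 `stub_prop8StepCoP13`'s letters: [15] Prop. 8's top step at NODE 00's objects (N07's lane; `2L² ≤ B₃` its inhabitation floor)
    (hB₃ : 2 * (F.L : ℝ) ^ 2 ≤ B₃) (ha₀ : 0 < a₀) (ha₁ : 0 < a₁) (h8 : Prop8RegSepTopStep F 2 (fun ν K Ω => suppDomOfRecord F ν K Ω) B₃ a₀ a₁)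
    -- stub 2 `stub_prop6MemberB8At13`'s letters: [6] Prop. 6 at NODE 00's ℤ⁴ cube member (N05∕N06 junction β)
    (hB₁ : 0 ≤ B₁) (hc₁ : 0 < c₁) (hP6 : letI : CStarAlgebra (MatA 2) := {}; B8.Prop6Printed 4 (F.L : ℝ) B₁ c₁ (fun i : B8LeafModelZd.ZdIdx 4 F.L => zdCub (MatA 2) F.L i))
    -- the witness letters (dag-n21-c FILE C ∕ Cʷ): `B₃' = B₉·B₃`, `a₁' = min a₁ (a₀''∕B₃)` — two display equations, `rfl` at the closer
    (hB₃' : B₃' = b9Of F (F.L ^ 3) B₁ * B₃) (ha₁' : a₁' = min a₁ (a0Of F 2 (F.L ^ 3) B₁ c₁ / B₃))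
    -- the SIGN-FREE stub 3ᴬ's conclusion at these letters (all-torus Eʷ's binders; V17 `stub_absBetaBoxAtThm1WitnessCCM13` via Cʷ′ `windowLettersBox_of_absBetaBox` + `box_mono` down to γ): `0 < γ`, `ε₀ ε₂₉`,
    -- the TWO-SIDED box `bl ≤ β ≤ β'` ON `]0, γ]` of `betaOfRecord₁₃ F 2 θ₁₅ᶜᶜᴹ(3)` (`bl` of either sign), `−bl·γ² ≤ 3`, `β'·γ² ≤ ¾`
    (hγ0 : 0 < γ) (hε : 0 < ε₀) (hε' : 0 < ε₂₉) {bl β' : ℝ} (hβlo : BetaLowerH bl γ (betaOfRecord₁₃ F 2 (theta13OfThm1CCM F 2 3 ε₀ ε₂₉ B₃ B₃' a₀ a₁')))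
    (hβhi : BetaUpperH β' γ (betaOfRecord₁₃ F 2 (theta13OfThm1CCM F 2 3 ε₀ ε₂₉ B₃ B₃' a₀ a₁'))) (hl : -bl * γ ^ 2 ≤ 3) (hu : β' * γ ^ 2 ≤ 3 / 4)
    -- the closer's window choice inside NODE O's window, made (2.7)-small EXPLICITLY: `γ ≤ e⁻³` (whence `γ ≤ ½`; with `hu`, `γ²·max β' 0 ≤ 1`) — NO `γ ≤ ½`, NO `0 ≤ β'`, NO `γ²β' ≤ 1` binder
    (hγe : γ ≤ Real.exp (-3))
    -- the mixed W-pin AT THE LAYER OF RECORD λᴾ: below the torus `W₀ P` IS the bundle of record at λᴾ; elsewhere the closer's leaf-carrying `W₀ P`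
    (hW : ∀ P : B12.RunParams, lam.kSel P < P.K → W₀ P = WOfRecord₁₃ F 2 (theta13OfThm1CCMW F 2 3 γ ε₀ ε₂₉ B₃ B₃' a₀ a₁')
      ((lam.pinRPrime₁₃ (theta13OfThm1CCMW F 2 3 γ ε₀ ε₂₉ B₃ B₃' a₀ a₁')).pinD189ΛH (theta13OfThm1CCMW F 2 3 γ ε₀ ε₂₉ B₃ B₃' a₀ a₁').ν (theta13OfThm1CCMW F 2 3 γ ε₀ ε₂₉ B₃ B₃' a₀ a₁').A₁ (theta13OfThm1CCMW F 2 3 γ ε₀ ε₂₉ B₃ B₃' a₀ a₁').τ9.M (gOfRecord₁₃ F 2 (theta13OfThm1CCMW F 2 3 γ ε₀ ε₂₉ B₃ B₃' a₀ a₁'))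
        (fun P => (((((σ P).pinZres (theta13OfThm1CCMW F 2 3 γ ε₀ ε₂₉ B₃ B₃' a₀ a₁').ν (theta13OfThm1CCMW F 2 3 γ ε₀ ε₂₉ B₃ B₃' a₀ a₁').τ9.M (gOfRecord₁₃ F 2 (theta13OfThm1CCMW F 2 3 γ ε₀ ε₂₉ B₃ B₃' a₀ a₁') P) (s P) (N0OfRecord₁₃ (theta13OfThm1CCMW F 2 3 γ ε₀ ε₂₉ B₃ B₃' a₀ a₁') P (lam.kSel P + 1))).pinSides (theta13OfThm1CCMW F 2 3 γ ε₀ ε₂₉ B₃ B₃' a₀ a₁').ν (gOfRecord₁₃ F 2 (theta13OfThm1CCMW F 2 3 γ ε₀ ε₂₉ B₃ B₃' a₀ a₁') P) (lam.kSel P + 1 - Nm P) (lam.kSel P + 1)).pinXΩ4 (s P) (enlD F (theta13OfThm1CCMW F 2 3 γ ε₀ ε₂₉ B₃ B₃' a₀ a₁').ν (theta13OfThm1CCMW F 2 3 γ ε₀ ε₂₉ B₃ B₃' a₀ a₁').τ9.M P (gOfRecord₁₃ F 2 (theta13OfThm1CCMW F 2 3 γ ε₀ ε₂₉ B₃ B₃'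 a₀ a₁') P))).pinOmegaPP (s P) (Nm P) (enlD F (theta13OfThm1CCMW F 2 3 γ ε₀ ε₂₉ B₃ B₃' a₀ a₁').ν (theta13OfThm1CCMW F 2 3 γ ε₀ ε₂₉ B₃ B₃' a₀ a₁').τ9.M P (gOfRecord₁₃ F 2 (theta13OfThm1CCMW F 2 3 γ ε₀ ε₂₉ B₃ B₃' a₀ a₁') P)))) s Nm p₁) P)
    (hWdeg : ∀ P : B12.RunParams, P.K ≤ lam.kSel P → B15Leaf (W₀ P))
    (hC : w.C = (datumOfRecord₁₃SepCoPH F 2 (Stage13HParams.ofHistoryBlind F 2 (Stage13RParams.ofCured F 2 (theta13OfThm1CCMW F 2 3 γ ε₀ ε₂₉ B₃ B₃' a₀ a₁'))) (provisos₁₃SepCoP_theta13OfThm1CCMW_cube_of_prop8TopStep_of_prop6Member_of_betaBoxSignFree_allTorus hB₃ ha₀ ha₁ h8 hB₁ hc₁ hP6 hB₃' ha₁' hγ0 (hγe.trans exp_neg_three_lt_half.le) hε hε' hβlo hβhi hl hu).ofCured.ofHistoryBlind).C) (hγ : 0 < w.γ ∧ w.γ ≤ (theta13OfThm1CCMW F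 2 3 γ ε₀ ε₂₉ B₃ B₃' a₀ a₁').γ) (hL : w.L = ((theta13OfThm1CCMW F 2 3 γ ε₀ ε₂₉ B₃ B₃' a₀ a₁').L : ℝ))
    (hup : ∀ P, w.up P = upOfRecord₅CS F 2 ((((((Stage13HParams.ofHistoryBlind F 2 (Stage13RParams.ofCured F 2 (theta13OfThm1CCMW F 2 3 γ ε₀ ε₂₉ B₃ B₃' a₀ a₁'))).toStage5₁₃CoPH F 2).pinB10 F 2).pinY F 2 (Y9OfRecord 2 (theta13OfThm1CCMW F 2 3 γ ε₀ ε₂₉ B₃ B₃' a₀ a₁').toStage3Params Mstar ops)).pinZ F 2 (Z11OfRecord F 2 ζ)).pinW F 2 W₀) P)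
    (h05S : ∀ P : B12.RunParams, (upOfRecord₅CS F 2 ((((((Stage13HParams.ofHistoryBlind F 2 (Stage13RParams.ofCured F 2 (theta13OfThm1CCMW F 2 3 γ ε₀ ε₂₉ B₃ B₃' a₀ a₁'))).toStage5₁₃CoPH F 2).pinB10 F 2).pinY F 2 (Y9OfRecord 2 (theta13OfThm1CCMW F 2 3 γ ε₀ ε₂₉ B₃ B₃' a₀ a₁').toStage3Params Mstar ops)).pinZ F 2 (Z11OfRecord F 2 ζ)).pinW F 2 W₀) P).b8)
    (h06 : B9LeafX (Y9OfRecord 2 (theta13OfThm1CCMW F 2 3 γ ε₀ ε₂₉ B₃ B₃' a₀ a₁').toStage3Params Mstar ops))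
    (h07 : B11Leaf (Z11OfRecord F 2 ζ))
    (h08 : PrintedUV3V 2 (theta13OfThm1CCMW F 2 3 γ ε₀ ε₂₉ B₃ B₃' a₀ a₁').L)
    (h09 : ∀ P : B12.RunParams, B12Sec2to5.Lemma4Printed ((theta13OfThm1CCMW F 2 3 γ ε₀ ε₂₉ B₃ B₃' a₀ a₁').res.X P).F12 ((theta13OfThm1CCMW F 2 3 γ ε₀ ε₂₉ B₃ B₃' a₀ a₁').res.X P).c12)
    (h09T : ∀ P : B12.RunParams, (leavesP w P).smallCouplings → (leavesP w P).smallFieldInductive)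
    (h10 : ∀ P : B12.RunParams, B9LeafX (Y9OfRecord 2 (theta13OfThm1CCMW F 2 3 γ ε₀ ε₂₉ B₃ B₃' a₀ a₁').toStage3Params Mstar ops) →
      (B10.Thm1PrintedCompact (((((((Stage13HParams.ofHistoryBlind F 2 (Stage13RParams.ofCured F 2 (theta13OfThm1CCMW F 2 3 γ ε₀ ε₂₉ B₃ B₃' a₀ a₁'))).toStage5₁₃CoPH F 2).pinB10 F 2).pinY F 2 (Y9OfRecord 2 (theta13OfThm1CCMW F 2 3 γ ε₀ ε₂₉ B₃ B₃' a₀ a₁').toStage3Params Mstar ops)).pinZ F 2 (Z11OfRecord F 2 ζ)).pinW F 2 W₀).res.X P).runs10 ∧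
          B10.Thm2Printed (((((((Stage13HParams.ofHistoryBlind F 2 (Stage13RParams.ofCured F 2 (theta13OfThm1CCMW F 2 3 γ ε₀ ε₂₉ B₃ B₃' a₀ a₁'))).toStage5₁₃CoPH F 2).pinB10 F 2).pinY F 2 (Y9OfRecord 2 (theta13OfThm1CCMW F 2 3 γ ε₀ ε₂₉ B₃ B₃' a₀ a₁').toStage3Params Mstar ops)).pinZ F 2 (Z11OfRecord F 2 ζ)).pinW F 2 W₀).res.X P).runs10) →
        B11Leaf (Z11OfRecord F 2 ζ) → B12Sec2to5.Lemma4Printed ((theta13OfThm1CCMW F 2 3 γ ε₀ ε₂₉ B₃ B₃' a₀ a₁').res.X P).F12 ((theta13OfThm1CCMW F 2 3 γ ε₀ ε₂₉ B₃ B₃' a₀ a₁').res.X P).c12 →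
          B13.Lemma1Printed ((theta13OfThm1CCMW F 2 3 γ ε₀ ε₂₉ B₃ B₃' a₀ a₁').res.X P).S13 ((theta13OfThm1CCMW F 2 3 γ ε₀ ε₂₉ B₃ B₃' a₀ a₁').res.X P).c13 ∧ B13.Lemma2Printed ((theta13OfThm1CCMW F 2 3 γ ε₀ ε₂₉ B₃ B₃' a₀ a₁').res.X P).S13 ((theta13OfThm1CCMW F 2 3 γ ε₀ ε₂₉ B₃ B₃' a₀ a₁').res.X P).c13 ∧
            B13.Lemma3Printed ((theta13OfThm1CCMW F 2 3 γ ε₀ ε₂₉ B₃ B₃' a₀ a₁').res.X P).S13 ((theta13OfThm1CCMW F 2 3 γ ε₀ ε₂₉ B₃ B₃' a₀ a₁').res.X P).c13)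
    (h11 : ∀ P : B12.RunParams, (leavesP w P).b7 → (leavesP w P).b8 → (leavesP w P).b9 → (leavesP w P).b10 → (leavesP w P).b11 →
      (leavesP w P).smallCouplings → (leavesP w P).smallFieldInductive → (leavesP w P).flowControl →
        ∀ k, k < P.K → SLaw₁₃CoPH F 2 (Stage13HParams.ofHistoryBlind F 2 (Stage13RParams.ofCured F 2 (theta13OfThm1CCMW F 2 3 γ ε₀ ε₂₉ B₃ B₃' a₀ a₁'))) P k → TLaw₁₃CoPH F 2 (Stage13HParams.ofHistoryBlind F 2 (Stage13RParams.ofCured F 2 (theta13OfThm1CCMW F 2 3 γ ε₀ ε₂₉ B₃ B₃' a₀ a₁'))) P k)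
    (hUV : ∀ P : B12.RunParams, (genFlow (betaOfRecord₁₃ F 2 (theta13OfThm1CCMW F 2 3 γ ε₀ ε₂₉ B₃ B₃' a₀ a₁')) P.g0).InInterval w.γ P.K → ∀ k, k ≤ P.K → SLaw₁₃CoPH F 2 (Stage13HParams.ofHistoryBlind F 2 (Stage13RParams.ofCured F 2 (theta13OfThm1CCMW F 2 3 γ ε₀ ε₂₉ B₃ B₃' a₀ a₁'))) P k →
      ∀ U : GaugeField (F.P P.K) k (SU 2),
        chiβOfRecord₁₃ F 2 (theta13OfThm1CCMW F 2 3 γ ε₀ ε₂₉ B₃ B₃' a₀ a₁') P.K (gOfRecord₁₃ F 2 (theta13OfThm1CCMW F 2 3 γ ε₀ ε₂₉ B₃ B₃' a₀ a₁') P) k U *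
              Real.exp (-(1 / (gOfRecord₁₃ F 2 (theta13OfThm1CCMW F 2 3 γ ε₀ ε₂₉ B₃ B₃' a₀ a₁') P k) ^ 2 * wilsonBGOfRecord F 2 (theta13OfThm1CCMW F 2 3 γ ε₀ ε₂₉ B₃ B₃' a₀ a₁').εbg P k U)
                - w.em (gOfRecord₁₃ F 2 (theta13OfThm1CCMW F 2 3 γ ε₀ ε₂₉ B₃ B₃' a₀ a₁') P k) * (Fintype.card (Site (F.P P.K) k) : ℝ)) ≤ densOfRecord₁₃ F 2 (theta13OfThm1CCMW F 2 3 γ ε₀ ε₂₉ B₃ B₃' a₀ a₁') P k U ∧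
        densOfRecord₁₃ F 2 (theta13OfThm1CCMW F 2 3 γ ε₀ ε₂₉ B₃ B₃' a₀ a₁') P k U ≤ Real.exp (w.ep (gOfRecord₁₃ F 2 (theta13OfThm1CCMW F 2 3 γ ε₀ ε₂₉ B₃ B₃' a₀ a₁') P k) * (Fintype.card (Site (F.P P.K) k) : ℝ)))
    -- N12 AT THE LAYER OF RECORD IN NODE O's (2.7)-SMALL WINDOW: 12Pᵂ's located per-run inputs, run by run, BELOW THE TORUS ONLY (`D P` abbreviates the pinned (1.89) setting `λᴾ.D189 P`)
    (D : ∀ P : B12.RunParams, Setting189 (F.P P.K) (SU 2) (MSField (F.P P.K) (SU 2) × ((j : ℕ) → VecField (F.P P.K) j (EuclideanSpace ℝ (Fin (2 ^ 2 - 1))))) (Pt (F.P P.K).d))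
    (hD : ∀ P : B12.RunParams, D P = ((lam.pinRPrime₁₃ (theta13OfThm1CCMW F 2 3 γ ε₀ ε₂₉ B₃ B₃' a₀ a₁')).pinD189ΛH (theta13OfThm1CCMW F 2 3 γ ε₀ ε₂₉ B₃ B₃' a₀ a₁').ν (theta13OfThm1CCMW F 2 3 γ ε₀ ε₂₉ B₃ B₃' a₀ a₁').A₁ (theta13OfThm1CCMW F 2 3 γ ε₀ ε₂₉ B₃ B₃' a₀ a₁').τ9.M (gOfRecord₁₃ F 2 (theta13OfThm1CCMW F 2 3 γ ε₀ ε₂₉ B₃ B₃' a₀ a₁')) (fun P => (((((σ P).pinZres (theta13OfThm1CCMW F 2 3 γ ε₀ ε₂₉ B₃ B₃' a₀ a₁').ν (theta13OfThm1CCMW F 2 3 γ ε₀ ε₂₉ B₃ B₃' a₀ a₁').τ9.M (gOfRecord₁₃ F 2 (theta13OfThm1CCMW F 2 3 γ ε₀ ε₂₉ B₃ B₃' a₀ a₁') P) (s P) (N0OfRecord₁₃ (theta13OfThm1CCMW F 2 3 γ ε₀ ε₂₉ B₃ B₃' a₀ a₁') P (lam.kSel P + 1))).pinSides (theta13OfThm1CCMW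 F 2 3 γ ε₀ ε₂₉ B₃ B₃' a₀ a₁').ν (gOfRecord₁₃ F 2 (theta13OfThm1CCMW F 2 3 γ ε₀ ε₂₉ B₃ B₃' a₀ a₁') P) (lam.kSel P + 1 - Nm P) (lam.kSel P + 1)).pinXΩ4 (s P) (enlD F (theta13OfThm1CCMW F 2 3 γ ε₀ ε₂₉ B₃ B₃' a₀ a₁').ν (theta13OfThm1CCMW F 2 3 γ ε₀ ε₂₉ B₃ B₃' a₀ a₁').τ9.M P (gOfRecord₁₃ F 2 (theta13OfThm1CCMW F 2 3 γ ε₀ ε₂₉ B₃ B₃' a₀ a₁') P))).pinOmegaPP (s P) (Nm P) (enlD F (theta13OfThm1CCMW F 2 3 γ ε₀ ε₂₉ B₃ B₃' a₀ a₁').ν (theta13OfThm1CCMW F 2 3 γ ε₀ ε₂₉ B₃ B₃' a₀ a₁').τ9.M P (gOfRecord₁₃ F 2 (theta13OfThm1CCMW F 2 3 γ ε₀ ε₂₉ B₃ B₃' a₀ a₁') P)))) s Nm p₁).D189 P)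
    (hmassLive : ∀ P : B12.RunParams, lam.kSel P < P.K → ∀ a, LiveSeq F 2 (theta13OfThm1CCMW F 2 3 γ ε₀ ε₂₉ B₃ B₃' a₀ a₁').ν (theta13OfThm1CCMW F 2 3 γ ε₀ ε₂₉ B₃ B₃' a₀ a₁').τ9 P (gOfRecord₁₃ F 2 (theta13OfThm1CCMW F 2 3 γ ε₀ ε₂₉ B₃ B₃' a₀ a₁') P) (lam.kSel P + 1)
        (slotsTOfRecord F 2 (theta13OfThm1CCMW F 2 3 γ ε₀ ε₂₉ B₃ B₃' a₀ a₁').ν (theta13OfThm1CCMW F 2 3 γ ε₀ ε₂₉ B₃ B₃' a₀ a₁').τ9 (EOfRecord₁₃ F 2 (theta13OfThm1CCMW F 2 3 γ ε₀ ε₂₉ B₃ B₃' a₀ a₁')) (wOfRecord₉ F 2 (theta13OfThm1CCMW F 2 3 γ ε₀ ε₂₉ B₃ B₃' a₀ a₁').toStage9Params)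
          (theta13OfThm1CCMW F 2 3 γ ε₀ ε₂₉ B₃ B₃' a₀ a₁').ppSel P (gOfRecord₁₃ F 2 (theta13OfThm1CCMW F 2 3 γ ε₀ ε₂₉ B₃ B₃' a₀ a₁') P) (lam.kSel P + 1)) a →
      0 < ∫ V, rterm (reprTOfRecord₁₃ F 2 (theta13OfThm1CCMW F 2 3 γ ε₀ ε₂₉ B₃ B₃' a₀ a₁') P (lam.kSel P)) a V ∂(fieldMeasure (F.P P.K) (lam.kSel P + 1) (SU 2)))
    (hP1 : ∀ P : B12.RunParams, lam.kSel P < P.K → Prop1Printed (lam.LF P))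
    (hNN : ∀ P : B12.RunParams, lam.kSel P < P.K → N0OfRecord₁₃ (theta13OfThm1CCMW F 2 3 γ ε₀ ε₂₉ B₃ B₃' a₀ a₁') P (lam.kSel P + 1) ≤ Nm P)
    (hNk : ∀ P : B12.RunParams, lam.kSel P < P.K → N0OfRecord₁₃ (theta13OfThm1CCMW F 2 3 γ ε₀ ε₂₉ B₃ B₃' a₀ a₁') P (lam.kSel P + 1) ≤ lam.kSel P + 1)
    (hβ0 : ∀ P : B12.RunParams, lam.kSel P < P.K → 0 ≤ (σ P).β)
    (hβ : ∀ P : B12.RunParams, lam.kSel P < P.K → (σ P).β ≤ 1 / 4)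
    (hL₀ : ∀ P : B12.RunParams, lam.kSel P < P.K → 2 ≤ (σ P).L₀)
    (hL₀L : ∀ P : B12.RunParams, lam.kSel P < P.K → (σ P).L₀ ^ 2 ≤ ((F.P P.K).L : ℝ))
    (hB : ∀ P : B12.RunParams, lam.kSel P < P.K → 0 ≤ (σ P).O1 * (σ P).B₃ * (σ P).B₅)
    (hδ : ∀ P : B12.RunParams, lam.kSel P < P.K → 0 ≤ (σ P).δ)
    (hwin : ∀ P : B12.RunParams, lam.kSel P < P.K → 4 * (2 + (121 / 120) ^ 2 * ((σ P).O1 * (σ P).B₃ * (σ P).B₅ * ((theta13OfThm1CCMW F 2 3 γ ε₀ ε₂₉ B₃ B₃' a₀ a₁').τ9.M : ℝ) ^ 5))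
      ≤ ((Real.log ((gOfRecord₁₃ F 2 (theta13OfThm1CCMW F 2 3 γ ε₀ ε₂₉ B₃ B₃' a₀ a₁') P) (lam.kSel P + 1) ^ 2)⁻¹) ^ (theta13OfThm1CCMW F 2 3 γ ε₀ ε₂₉ B₃ B₃' a₀ a₁').ν.r) ^ (Real.log ((σ P).L₀ ^ 2) / Real.log ((F.P P.K).L : ℝ)))
    (hβhist : ∀ P : B12.RunParams, lam.kSel P < P.K → ∀ j, j < lam.kSel P + 1 → 0 ≤ betaOfRecord₁₃ F 2 (theta13OfThm1CCMW F 2 3 γ ε₀ ε₂₉ B₃ B₃' a₀ a₁') j (prefixOf (gOfRecord₁₃ F 2 (theta13OfThm1CCMW F 2 3 γ ε₀ ε₂₉ B₃ B₃' a₀ a₁') P) j))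
    (hMl : ∀ P : B12.RunParams, lam.kSel P < P.K → (121 / 120) ^ 2 * ((σ P).O1 * (σ P).B₃ * (σ P).B₅ * ((theta13OfThm1CCMW F 2 3 γ ε₀ ε₂₉ B₃ B₃' a₀ a₁').τ9.M : ℝ) ^ 5) * Real.exp (-(4 * (σ P).δ * ((theta13OfThm1CCMW F 2 3 γ ε₀ ε₂₉ B₃ B₃' a₀ a₁').τ9.M : ℝ))) ≤ 1 / 12)
    (hI : ∀ P : B12.RunParams, lam.kSel P < P.K → Step.InInterval (theta13OfThm1CCMW F 2 3 γ ε₀ ε₂₉ B₃ B₃' a₀ a₁').γ (lam.kSel P + 1) (gOfRecord₁₃ F 2 (theta13OfThm1CCMW F 2 3 γ ε₀ ε₂₉ B₃ B₃' a₀ a₁') P))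
    (hΛ : ∀ P : B12.RunParams, lam.kSel P < P.K → (((enlD F (theta13OfThm1CCMW F 2 3 γ ε₀ ε₂₉ B₃ B₃' a₀ a₁').ν (theta13OfThm1CCMW F 2 3 γ ε₀ ε₂₉ B₃ B₃' a₀ a₁').τ9.M P (gOfRecord₁₃ F 2 (theta13OfThm1CCMW F 2 3 γ ε₀ ε₂₉ B₃ B₃' a₀ a₁') P)) 4 (lam.kSel P + 1 + 1 - (N0OfRecord₁₃ (theta13OfThm1CCMW F 2 3 γ ε₀ ε₂₉ B₃ B₃' a₀ a₁') P (lam.kSel P + 1)))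
        (omegaOfChain (s P) (lam.kSel P + 1 + 1 - (N0OfRecord₁₃ (theta13OfThm1CCMW F 2 3 γ ε₀ ε₂₉ B₃ B₃' a₀ a₁') P (lam.kSel P + 1)))))ᶜ ∩ (σ P).Z).Nonempty)
    (L91h : ∀ P : B12.RunParams, lam.kSel P < P.K → ∀ U, new189 (D P) U → ∀ p ∈ plaqsOf (half (D P)),
      Ineq191 (dist1 (plaqHol ((D P).Upp U) p)) ((D P).devV'' U p) (D P).α (((D P).L ^ (D P).h)⁻¹) ((D P).ε (D P).h) (E124 (D P).ε (D P).L (D P).η (D P).k (D P).h))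
    (L95 : ∀ P : B12.RunParams, lam.kSel P < P.K → ∀ U, new189 (D P) U → ∀ p ∈ plaqsOf (half (D P)),
      Ineq195 ((D P).devV'' U p) (dist1 (plaqHol ((D P).Uhalf U ((D P).boxOf p)) p)) (D P).α (((D P).L ^ (D P).h)⁻¹) ((D P).ε (D P).h) (E124 (D P).ε (D P).L (D P).η (D P).k (D P).h))
    (L91 : ∀ P : B12.RunParams, lam.kSel P < P.K → ∀ U, new189 (D P) U → ∀ j, (D P).h ≤ j → j ≤ (D P).k → ∀ p ∈ plaqsOf (dom (D P) j),
      Ineq191 (dist1 (plaqHol ((D P).Upp U) p)) ((D P).dev97 U p) (D P).α (((D P).L ^ j)⁻¹) ((D P).ε j) (E124 (D P).ε (D P).L (D P).η (D P).k j))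
    (L97 : ∀ P : B12.RunParams, lam.kSel P < P.K → ∀ U, new189 (D P) U → ∀ j, (D P).h ≤ j → j ≤ (D P).k → ∀ p ∈ plaqsOf (dom (D P) j),
      Ineq191 ((D P).dev97 U p) ((D P).dev0 U p) (D P).α (((D P).L ^ j)⁻¹) ((D P).ε j) (E124 (D P).ε (D P).L (D P).η (D P).k j))
    (L80 : ∀ P : B12.RunParams, lam.kSel P < P.K → ∀ U, new189 (D P) U → ∀ j, (D P).h ≤ j → j ≤ (D P).k → ∀ p ∈ plaqsOf (dom (D P) j),
      Ineq180 ((D P).dev0 U p) ((D P).ε (D P).k) (D P).η (D P).B₃ (D P).B₅ (D P).M (D P).δ ((D P).dist p) (D P).O1)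
    (hsel : ∀ P : B12.RunParams, 1 ≤ P.K → lam.kSel P < P.K) :
    ∃ (θ' : Stage13HParams F 2) (h' : θ'.Provisos₁₃SepCoPH F 2) (w : WorldP), (θ'.ZhUnity F 2 ∧ θ'.SlotsNondegenerate₁₃ F 2) ∧ θ'.Admissible F 2 ∧
      (∃ (θ'' : Stage13HParams F 2) (h'' : θ''.Provisos₁₃SepCoPH F 2), θ''.Admissible F 2 ∧
        datumOfRecord₁₃SepCoPH F 2 θ' h' = datumOfRecord₁₃SepCoPH F 2 θ'' h'' ∧ w.C = (datumOfRecord₁₃SepCoPH F 2 θ' h').C ∧ (0 < w.γ ∧ w.γ ≤ θ''.γ) ∧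
        w.L = (θ''.L : ℝ) ∧ ∀ P : B12.RunParams, w.up P = upOfRecord₅CS F 2 (θ''.toStage5₁₃CoPH F 2) P) ∧
      (∀ P : B12.RunParams, Nodes (leavesP w P)) ∧ PrintedUV3V 2 θ'.L ∧
      ∃ lam : ResidW F 2, (∀ P : B12.RunParams, 1 ≤ P.K → lam.kSel P < P.K) ∧
        ∀ P : B12.RunParams, lam.kSel P < P.K → ((leavesP w P).rBasicStep ↔ B15Leaf (WOfRecord₁₃ F 2 θ'.toStage13Params lam P)) := by
  subst hB₃' ha₁'
  -- the window: `γ ≤ e⁻³ < ½` (12Iᵂ v1.2 §3); the (2.7) letters at the NON-NEGATIVE bound `max β' 0` (the box and `hu` transfer; `γ²·max β' 0 ≤ 1` from `β'γ² ≤ ¾`)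
  have hγh : γ ≤ 1 / 2 := (hγe.trans exp_neg_three_lt_half.le)
  have hβhi' : BetaUpperH (max β' 0) γ (betaOfRecord₁₃ F 2 (theta13OfThm1CCM F 2 3 ε₀ ε₂₉ B₃ (b9Of F (F.L ^ 3) B₁ * B₃) a₀ (min a₁ (a0Of F 2 (F.L ^ 3) B₁ c₁ / B₃)))) :=
    fun k v hv => (hβhi k v hv).trans (le_max_left _ _)
  have hγβ' : γ ^ 2 * max β' 0 ≤ 1 := by
    rcases le_total β' 0 with hβ'0 | hβ'0
    · rw [max_eq_right hβ'0, mul_zero]; exact zero_le_one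
    · rw [max_eq_left hβ'0]; nlinarith [hu, sq_nonneg γ]
  -- the witness's `A₀ = A₀ᶜᶜ¹(L, B₃, B₉B₃, a₀, a₁') ∈ [0, 1∕16]` (K0a) for the flow-profile letter (12Iᵂ §0); `r = p₀ = M₂ = 1`, `M = L³`, `θ.γ = γ` by `rfl`
  have hA : 0 ≤ A0OfThm1CC1 F.L B₃ (b9Of F (F.L ^ 3) B₁ * B₃) a₀ (min a₁ (a0Of F 2 (F.L ^ 3) B₁ c₁ / B₃)) :=
    A0OfThm1CC1_nonneg (floor_nonneg hB₃) (b9_mul_nonneg hB₃ hB₁) ha₀.le (shrunkCeiling_pos F (F.L ^ 3) (floor_pos hB₃) hB₁ hc₁ ha₁).le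
  have hA' : A0OfThm1CC1 F.L B₃ (b9Of F (F.L ^ 3) B₁ * B₃) a₀ (min a₁ (a0Of F 2 (F.L ^ 3) B₁ c₁ / B₃)) ≤ 1 / 16 :=
    (A0OfThm1CC1_le (floor_nonneg hB₃) (b9_mul_nonneg hB₃ hB₁) ha₀.le (shrunkCeiling_pos F (F.L ^ 3) (floor_pos hB₃) hB₁ hc₁ ha₁).le).trans (A0OfThm1C_le_sixteenth (floor_nonneg hB₃))
  exact nodesAtSomeRecordS₁₃SepCoPH_of_upS_fourPinW₀_pinnedΛΩχZ_ofHistoryBlind_ofCured_liveRepin₁₃_of_massLive_of_hasResiduals_of_inInterval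
    (theta13OfNumerics F 2 (stage12NumericsOfThm1CCMW F.L 3 γ ε₀ B₃ (b9Of F (F.L ^ 3) B₁ * B₃) a₀ (min a₁ (a0Of F 2 (F.L ^ 3) B₁ c₁ / B₃))) ε₂₉ (zeta316OfRecord F 2 (stage12NumericsOfThm1CCMW F.L 3 γ ε₀ B₃ (b9Of F (F.L ^ 3) B₁ * B₃) a₀ (min a₁ (a0Of F 2 (F.L ^ 3) B₁ c₁ / B₃))).ν (stage12NumericsOfThm1CCMW F.L 3 γ ε₀ B₃ (b9Of F (F.L ^ 3) B₁ * B₃) a₀ (min a₁ (a0Of F 2 (F.L ^ 3) B₁ c₁ / B₃))).τ9.M (stage12NumericsOfThm1CCMW F.L 3 γ ε₀ B₃ (b9Of F (F.L ^ 3) B₁ * B₃) a₀ (min a₁ (a0Of F 2 (F.L ^ 3) B₁ c₁ / B₃))).A₁) (RzOfRecord F 2) (ZtOfRecord F 2)) lam σ s Nm p₁ Mstar ops ζ W₀ w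
    (hasResidualsOfRecord_theta13OfNumerics F 2 (stage12NumericsOfThm1CCMW F.L 3 γ ε₀ B₃ (b9Of F (F.L ^ 3) B₁ * B₃) a₀ (min a₁ (a0Of F 2 (F.L ^ 3) B₁ c₁ / B₃))) ε₂₉)
    (provisos₁₃SepCoP_theta13OfThm1CCMW_cube_of_prop8TopStep_of_prop6Member_of_betaBoxSignFree_allTorus hB₃ ha₀ ha₁ h8 hB₁ hc₁ hP6 rfl rfl hγ0 hγh hε hε' hβlo hβhi hl hu)
    (admissible_theta13OfNumerics F 2 (zeta316OfRecord F 2 (stage12NumericsOfThm1CCMW F.L 3 γ ε₀ B₃ (b9Of F (F.L ^ 3) B₁ * B₃) a₀ (min a₁ (a0Of F 2 (F.L ^ 3) B₁ c₁ / B₃))).ν (stage12NumericsOfThm1CCMW F.L 3 γ ε₀ B₃ (b9Of F (F.L ^ 3) B₁ * B₃) a₀ (min a₁ (a0Of F 2 (F.L ^ 3) B₁ c₁ / B₃))).τ9.M (stage12NumericsOfThm1CCMW F.L 3 γ ε₀ B₃ (b9Of F (F.L ^ 3) B₁ * B₃) a₀ (min a₁ (a0Of F 2 (F.L ^ 3)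 B₁ c₁ / B₃))).A₁) (RzOfRecord F 2) (ZtOfRecord F 2) (stage12NumericsOfThm1CCMW_pos_of_le_half F.hL.2.le hγ0 hγh hε (floor_nonneg hB₃) (b9_mul_nonneg hB₃ hB₁) ha₀ (shrunkCeiling_pos F (F.L ^ 3) (floor_pos hB₃) hB₁ hc₁ ha₁)) hε')
    (kappa_nonneg_theta13OfThm1CCM F 2 3 ε₀ ε₂₉ B₃ (b9Of F (F.L ^ 3) B₁ * B₃) a₀ (min a₁ (a0Of F 2 (F.L ^ 3) B₁ c₁ / B₃))) (E0_nonneg_theta13OfThm1CCM F 2 3 ε₀ ε₂₉ B₃ (b9Of F (F.L ^ 3) B₁ * B₃) a₀ (min a₁ (a0Of F 2 (F.L ^ 3) B₁ c₁ / B₃))) (B0_nonneg_theta13OfThm1CCM F 2 3 ε₀ ε₂₉ B₃ (b9Of F (F.L ^ 3) B₁ * B₃) a₀ (min a₁ (a0Of F 2 (F.L ^ 3) B₁ c₁ / B₃)))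
    hW hWdeg hC hγ hL hup h05S h06 h07 h08 h09 h09T h10 h11 hUV
    Nat.one_pos -- `M₂ = 1`
    (pow_pos (Nat.zero_lt_of_lt F.hL.2) 3) -- `M = L³ > 0`
    D hD hmassLive hP1 le_rfl hNN hNk hβ0 hβ hL₀ hL₀L hB hδ hwin
    hβhist -- `β ≥ 0` along each run's history: DISPLAYED — N12 reads the sign of β through the coupling step of the (1.89) pin (NODE O's letter for N12; K0 does not read it)
    hMl hA (smallnessFor_half_two_one hγ0 hγe (le_max_right β' 0) hγβ') (by norm_num) (gamma_mul_p0Profile_le_tenth hγ0 hγh hA hA')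
    (betaUpperH_theta13OfThm1CCMW_of_half hγh hβhi') -- the (2.7) bound ⟸ the upper box, at `max β' 0`
    hI hΛ L91h L95 L91 L97 L80 hsel

end RungOfStubsWindow

end Summit.QuantumFields.YangMills.BalabanUVNodes.N12AtTheta13OfThm1CCMWCubeOfStubsSignFreeAllTorusWindow
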